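import Literature.Probability.Percolation.ProdBernoulliRusso
import Literature.Probability.LatticeModels.IsoradialPercolationProofs
import Summits.CriticalPhenomena.PercolationContinuityZ3.Theses.PercNearOneGluing
import Summits.CriticalPhenomena.PercolationContinuityZ3.Theorems.AdditiveGluing.Negative.CertChecker

/-!
# `AdditiveGluing` (crux stmt-CriticalPhenomena-4576, route `PercNearOneGluing`):
# soundness of the certified density-`1/2` checker `agAll`, and the certificate for `n ≤ 5`

Continuation of `CertChecker.lean` (ccert seat).  Proved here, sorry-free and with the standard
axioms only:

* `prodBernoulli_wHalf_real` — at the weights `wHalf E = 𝟙_E · 1/2` (i.e. `bondPercolation G half`,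
  `bondPercolation_eq_prodBernoulli_wHalf`) the probability of any event `D` is
  `#{S ⊆ E : ↑S ∈ D} / 2^{|E|}`;
* `real_openConn_eq`, `real_iUnion_openConn_eq` — hence `P(o ↔ b) = cntConn / 2^m` and
  `P(o ↔ A) = cntConnSet / 2^m` exactly;
* `additiveGluing_half_of_agAll` — **if `agAll n = true` then the additive gluing inequality holds
  for `bondPercolation G half` on EVERY simple graph `G` on `Fin n`, every relay set `A`, all `o b`
  and every admissible slack `t`**; `additiveGluing_indicatorHalf_of_agAll` is the same statement
  written, as in the crux, for `prodBernoulli (fun e => if e ∈ G.edgeSet then half else 0)`.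

Then THE CERTIFICATE (computational, `native_decide`, axiom `Lean.ofReduceBool` confined to the six
evaluations `agAll_zero … agAll_five`; `n = 5` is `1024` graphs, `59 049` configurations in total,
`800` triples `(o, b, A)` per graph, ≈ 12 s of compiled evaluation on the Lean farm):

* `additiveGluing_half_le_five` — for every `n ≤ 5`, every `G : SimpleGraph (Fin n)`, every
  `A o b t`: `0 ≤ t → (∀ a ∈ A, 1 − t ≤ P_{1/2}(a ↔ b)) → P_{1/2}(o ↔ A) − t ≤ P_{1/2}(o ↔ b)`;
* `additiveGluing_indicatorHalf_le_five` — the same in the literal `prodBernoulli` shape of the crux;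
* `additiveGluing_indicatorHalf_of_additiveGluing` — sanity link: the crux implies the block.

This is the Lean-checkable level of the exhaustive certificate programme for the crux (larger
levels — all graphs on `n ≤ 7` vertices, exact integer arithmetic — are kit computations attached to
the item as evidence and are not claimed here).  A violation of the crux at density `1/2` on `≤ 5`
vertices is thereby excluded by a kernel/compiler-checked proof.  By Kozma–Nitzan §5.6(1) density
`1/2` on simple graphs is a normal form of the weighted statement only asymptotically (gadget
blow-ups increase `n`), so nothing is claimed beyond `n ≤ 5`.  Nothing here asserts the crux.
-/

namespace Summit.CriticalPhenomena.PercolationContinuityZ3.Theorems.AdditiveGluing.Negative.Cert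

open MeasureTheory
open Literature.Probability.Percolation Literature.Probability.LatticeModels

/-! ### Probabilities at density `1/2` are counts -/

/-- Weight `1/2` on `E` and `0` elsewhere. -/
noncomputable def wHalf {n : ℕ} (E : Finset (Sym2 (Fin n))) : Sym2 (Fin n) → unitInterval :=
  fun e => if e ∈ E then half else 0

open Classical in
/-- At the weights `𝟙_E · 1/2` the product Bernoulli probability of ANY event is
`#{S ⊆ E : S ∈ D} / 2^{|E|}` (configurations not inside `E` have weight `0`, those inside have
weight `2^{-|E|}`; from the cylinder decomposition `RussoPath.prodBernoulli_real_eq_sum_powerset`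
over the finite coordinate set `univ`). -/
theorem prodBernoulli_wHalf_real {n : ℕ} (E : Finset (Sym2 (Fin n))) (D : Set (Set (Sym2 (Fin n)))) :
    (prodBernoulli (wHalf E)).real D =
      ((E.powerset.filter fun S : Finset (Sym2 (Fin n)) => (↑S : Set (Sym2 (Fin n))) ∈ D).card : ℝ) / 2 ^ E.card := by
  have hdet : DeterminedBy D (↑(Finset.univ : Finset (Sym2 (Fin n))) : Set (Sym2 (Fin n))) := by
    rw [determinedBy_iff]
    intro ω ω' h
    simp only [Finset.coe_univ, Set.inter_univ] at h
    rw [h]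
  rw [RussoPath.prodBernoulli_real_eq_sum_powerset hdet (wHalf E)]
  -- terms with `S ⊄ E` vanish; terms with `S ⊆ E` are `(1/2)^|E|`
  have hterm : ∀ S : Finset (Sym2 (Fin n)),
      (∏ i ∈ (Finset.univ : Finset (Sym2 (Fin n))),
          (if i ∈ S then ((wHalf E i : unitInterval) : ℝ) else 1 - (wHalf E i : ℝ))) =
        if S ⊆ E then (1 / 2) ^ E.card else 0 := by
    intro S
    by_cases hSE : S ⊆ E
    · rw [if_pos hSE]
      have : ∀ i ∈ (Finset.univ : Finset (Sym2 (Fin n))),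
          (if i ∈ S then ((wHalf E i : unitInterval) : ℝ) else 1 - (wHalf E i : ℝ)) =
            if i ∈ E then (1 / 2 : ℝ) else 1 := by
        intro i _
        by_cases hiS : i ∈ S
        · have hiE : i ∈ E := hSE hiS
          simp [hiS, hiE, wHalf]
        · by_cases hiE : i ∈ E
          · simp [hiS, hiE, wHalf]
            norm_num
          · simp [hiS, hiE, wHalf]
      rw [Finset.prod_congr rfl this, Finset.prod_ite_mem, Finset.univ_inter, Finset.prod_const]
    · rw [if_neg hSE]
      obtain ⟨i, hiS, hiE⟩ := Finset.not_subset.1 hSE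
      apply Finset.prod_eq_zero (Finset.mem_univ i)
      simp [hiS, hiE, wHalf]
  simp_rw [hterm]
  rw [← Finset.sum_subset (Finset.powerset_mono.2 (Finset.subset_univ E)), Finset.natCast_card_filter,
    Finset.sum_div]
  · refine Finset.sum_congr rfl fun S hS => ?_
    rw [Finset.mem_powerset] at hS
    by_cases hSD : (↑S : Set (Sym2 (Fin n))) ∈ D
    · simp [hSD, hS]
    · simp [hSD]
  · intro S _ hS
    rw [Finset.mem_powerset] at hS
    simp [hS]

/-! ### The edge list of a graph -/

/-- Membership in `allPairs`. -/
theorem mem_allPairs {n : ℕ} (p : Fin n × Fin n) : p ∈ allPairs n ↔ p.1 < p.2 := by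
  obtain ⟨a, b⟩ := p
  simp [allPairs]

/-- `allPairs n` has no duplicates. -/
theorem nodup_allPairs (n : ℕ) : (allPairs n).Nodup :=
  ((List.nodup_finRange n).product (List.nodup_finRange n)).filter _

/-- A sub-list of `allPairs n` has pairwise distinct unordered images. -/
theorem nodup_map_mk_of_sublist {n : ℕ} {es : List (Fin n × Fin n)} (h : es.Sublist (allPairs n)) :
    (es.map mkE).Nodup := by
  refine ((nodup_allPairs n).sublist h).map_on fun p hp q hq hpq => ?_
  have hp' := (mem_allPairs p).1 (h.subset hp)
  have hq' := (mem_allPairs q).1 (h.subset hq)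
  obtain ⟨c, d⟩ := q
  rcases (mkE_eq_iff p c d).1 hpq with rfl | rfl
  · rfl
  · exact absurd (hp'.trans hq') (lt_irrefl _)

/-- With distinct unordered images, the edge set has as many elements as the list. -/
theorem length_eq_card_Eset {n : ℕ} {es : List (Fin n × Fin n)} (h : (es.map mkE).Nodup) :
    (Eset es).card = es.length := by
  rw [Eset, List.toFinset_card_of_nodup h, List.length_map]

open Classical in
/-- The edge list of a simple graph on `Fin n`. -/
noncomputable def edgeList {n : ℕ} (G : SimpleGraph (Fin n)) : List (Fin n × Fin n) :=
  (allPairs n).filter fun p => G.Adj p.1 p.2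

/-- The edge list of a graph is a sub-list of `allPairs n` (so it is covered by `agAll n`). -/
theorem edgeList_sublist {n : ℕ} (G : SimpleGraph (Fin n)) : (edgeList G).Sublist (allPairs n) := by
  unfold edgeList; exact List.filter_sublist

/-- Membership in the edge list. -/
theorem mem_edgeList {n : ℕ} (G : SimpleGraph (Fin n)) (p : Fin n × Fin n) :
    p ∈ edgeList G ↔ p.1 < p.2 ∧ G.Adj p.1 p.2 := by
  unfold edgeList
  simp only [List.mem_filter, mem_allPairs, decide_eq_true_eq]

/-- The edge set of the edge list of `G` is `G.edgeSet`. -/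
theorem coe_Eset_edgeList {n : ℕ} (G : SimpleGraph (Fin n)) :
    (↑(Eset (edgeList G)) : Set (Sym2 (Fin n))) = G.edgeSet := by
  ext e
  induction e using Sym2.ind with
  | _ x y =>
    rw [Finset.mem_coe, mem_Eset_iff, SimpleGraph.mem_edgeSet]
    constructor
    · rintro ⟨p, hp, rfl | rfl⟩
      · exact ((mem_edgeList G _).1 hp).2
      · exact ((mem_edgeList G _).1 hp).2.symm
    · intro h
      rcases lt_or_gt_of_ne (G.ne_of_adj h) with hxy | hxy
      · exact ⟨(x, y), (mem_edgeList G _).2 ⟨hxy, h⟩, Or.inl rfl⟩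
      · exact ⟨(y, x), (mem_edgeList G _).2 ⟨hxy, h.symm⟩, Or.inr rfl⟩

open Classical in
/-- `P_{1/2}` on `G` is the product Bernoulli measure with weights `𝟙_{E(G)} · 1/2`
(`prodBernoulli_indicator_holds`). -/
theorem bondPercolation_eq_prodBernoulli_wHalf {n : ℕ} (G : SimpleGraph (Fin n)) :
    bondPercolation G half = prodBernoulli (wHalf (Eset (edgeList G))) := by
  rw [bondPercolation, ← prodBernoulli_indicator_holds G.edgeSet half]
  have hE : ∀ e, e ∈ Eset (edgeList G) ↔ e ∈ G.edgeSet := fun e => by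
    rw [← Finset.mem_coe, coe_Eset_edgeList]
  congr 1
  funext e
  simp only [wHalf, hE]

/-! ### Probabilities of the three events as counts -/

open Classical in
/-- The checker's two-point count is the number of sub-configurations in `{o ↔ b}`. -/
theorem cntConn_eq_card {n : ℕ} {es : List (Fin n × Fin n)} (hnd : (es.map mkE).Nodup) (o b : Fin n) :
    cntConn (tables n es) o b =
      ((Eset es).powerset.filter fun S : Finset (Sym2 (Fin n)) => (↑S : Set (Sym2 (Fin n))) ∈ openConn o b).card := by
  have h0 := card_filter_powerset_Eset es hnd
    (fun S : Finset (Sym2 (Fin n)) => decide ((↑S : Set (Sym2 (Fin n))) ∈ openConn o b))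
  have e1 : ((Eset es).powerset.filter fun S : Finset (Sym2 (Fin n)) =>
        decide ((↑S : Set (Sym2 (Fin n))) ∈ openConn o b) = true) =
      ((Eset es).powerset.filter fun S : Finset (Sym2 (Fin n)) => (↑S : Set (Sym2 (Fin n))) ∈ openConn o b) :=
    Finset.filter_congr fun S _ => by simp only [decide_eq_true_eq]
  have e2 : es.sublists'.countP ((fun tb : List ℕ => (tb.getD o 0).testBit b) ∘ reachTable n) =
      es.sublists'.countP fun ω => decide ((↑(Eset ω) : Set (Sym2 (Fin n))) ∈ openConn o b) :=
    List.countP_congr fun ω _ => by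
      rw [Function.comp_apply, testBit_reachTable_iff_mem_openConn, decide_eq_true_eq]
  rw [cntConn, tables, List.countP_map, e2, ← h0, e1]

open Classical in
/-- The checker's point-to-set count (set given by `maskL`) is the number of
sub-configurations in `{o ↔ A}`. -/
theorem cntConnSet_eq_card {n : ℕ} {es : List (Fin n × Fin n)} (hnd : (es.map mkE).Nodup) (o : Fin n)
    (A : Finset (Fin n)) :
    cntConnSet (tables n es) o (maskL A.toList) =
      ((Eset es).powerset.filter fun S : Finset (Sym2 (Fin n)) => (↑S : Set (Sym2 (Fin n))) ∈ ⋃ a ∈ A, openConn o a).card := by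
  have h0 := card_filter_powerset_Eset es hnd
    (fun S : Finset (Sym2 (Fin n)) => decide ((↑S : Set (Sym2 (Fin n))) ∈ ⋃ a ∈ A, openConn o a))
  have e1 : ((Eset es).powerset.filter fun S : Finset (Sym2 (Fin n)) =>
        decide ((↑S : Set (Sym2 (Fin n))) ∈ ⋃ a ∈ A, openConn o a) = true) =
      ((Eset es).powerset.filter fun S : Finset (Sym2 (Fin n)) => (↑S : Set (Sym2 (Fin n))) ∈ ⋃ a ∈ A, openConn o a) :=
    Finset.filter_congr fun S _ => by simp only [decide_eq_true_eq]
  have e2 : es.sublists'.countP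
        ((fun tb : List ℕ => tb.getD o 0 &&& maskL A.toList != 0) ∘ reachTable n) =
      es.sublists'.countP fun ω =>
        decide ((↑(Eset ω) : Set (Sym2 (Fin n))) ∈ ⋃ a ∈ A, openConn o a) :=
    List.countP_congr fun ω _ => by
      rw [Function.comp_apply, and_maskL_iff_mem_iUnion, decide_eq_true_eq]
  rw [cntConnSet, tables, List.countP_map, e2, ← h0, e1]

open Classical in
/-- `P_{1/2}(o ↔ b) = cntConn / 2^m`. -/
theorem real_openConn_eq {n : ℕ} {es : List (Fin n × Fin n)} (hnd : (es.map mkE).Nodup) (o b : Fin n) :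
    (prodBernoulli (wHalf (Eset es))).real (openConn o b) =
      (cntConn (tables n es) o b : ℝ) / 2 ^ es.length := by
  rw [prodBernoulli_wHalf_real, length_eq_card_Eset hnd, cntConn_eq_card hnd]

open Classical in
/-- `P_{1/2}(o ↔ A) = cntConnSet / 2^m`. -/
theorem real_iUnion_openConn_eq {n : ℕ} {es : List (Fin n × Fin n)} (hnd : (es.map mkE).Nodup)
    (o : Fin n) (A : Finset (Fin n)) :
    (prodBernoulli (wHalf (Eset es))).real (⋃ a ∈ A, openConn o a) =
      (cntConnSet (tables n es) o (maskL A.toList) : ℝ) / 2 ^ es.length := by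
  rw [prodBernoulli_wHalf_real, length_eq_card_Eset hnd, cntConnSet_eq_card hnd]

/-- There are `2^m` sub-configurations. -/
theorem length_tables {n : ℕ} (es : List (Fin n × Fin n)) : (tables n es).length = 2 ^ es.length := by
  rw [tables, List.length_map, List.length_sublists']

/-- Counts are at most `2^m`. -/
theorem cntConn_le {n : ℕ} (es : List (Fin n × Fin n)) (o b : ℕ) :
    cntConn (tables n es) o b ≤ 2 ^ es.length := by
  rw [← length_tables es]; exact List.countP_le_length

/-! ### Soundness of the checker -/

/-- What `agGraph n es = true` says about one `(o, b, A)` (table lookups unfolded). -/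
theorem agGraph_spec {n : ℕ} {es : List (Fin n × Fin n)} (h : agGraph n es = true)
    (o b : Fin n) {Am : ℕ} (hAm : Am < 2 ^ n) (hAm0 : Am ≠ 0) :
    ∃ a : Fin n, Am.testBit a = true ∧
      cntConnSet (tables n es) o Am ≤ cntConn (tables n es) o b +
        (2 ^ es.length - cntConn (tables n es) a b) := by
  simp only [agGraph, List.all_eq_true, List.mem_range, Bool.or_eq_true, beq_iff_eq,
    List.any_eq_true, Bool.and_eq_true, decide_eq_true_eq] at h
  obtain ⟨a, ha, hta, hle⟩ := (h o o.2 b b.2 Am hAm).resolve_left hAm0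
  refine ⟨⟨a, ha⟩, hta, ?_⟩
  rw [getD_map_range _ _ o.2, getD_map_range _ _ hAm, getD_map_range _ _ o.2, getD_map_range _ _ b.2,
    getD_map_range _ _ ha, getD_map_range _ _ b.2, length_tables] at hle
  exact hle

/-- **Soundness of the certified check.** If `agAll n = true` then the additive gluing
inequality holds for Bernoulli bond percolation at density `1/2` on EVERY simple graph with vertex
set `Fin n`, for every relay set `A`, all vertices `o b` and every admissible slack `t`. -/
theorem additiveGluing_half_of_agAll {n : ℕ} (h : agAll n = true) (G : SimpleGraph (Fin n))
    (A : Finset (Fin n)) (o b : Fin n) (t : ℝ) (ht : 0 ≤ t)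
    (hrel : ∀ a ∈ A, 1 - t ≤ (bondPercolation G half).real (openConn a b)) :
    (bondPercolation G half).real (⋃ a ∈ A, openConn o a) - t ≤
      (bondPercolation G half).real (openConn o b) := by
  classical
  set es := edgeList G with hes
  have hsub : es.Sublist (allPairs n) := edgeList_sublist G
  have hnd : (es.map mkE).Nodup := nodup_map_mk_of_sublist hsub
  have hg : agGraph n es = true := List.all_eq_true.1 h es (List.mem_sublists'.2 hsub)
  rw [bondPercolation_eq_prodBernoulli_wHalf G] at hrel ⊢
  rw [← hes] at hrel ⊢
  by_cases hA : A = ∅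
  · subst hA
    simp only [Finset.notMem_empty, Set.iUnion_of_empty, Set.iUnion_empty, measureReal_empty]
    linarith [measureReal_nonneg (μ := prodBernoulli (wHalf (Eset es))) (s := openConn o b)]
  obtain ⟨a0, ha0⟩ := Finset.nonempty_iff_ne_empty.2 hA
  have hAm0 : maskL A.toList ≠ 0 := by
    intro h0
    have := (testBit_maskL A.toList a0).2 ⟨a0, Finset.mem_toList.2 ha0, rfl⟩
    rw [h0, Nat.zero_testBit] at this
    exact Bool.false_ne_true this
  obtain ⟨a, hta, hle⟩ := agGraph_spec hg o b (maskL_lt A.toList) hAm0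
  have haA : a ∈ A := by
    obtain ⟨a', ha', haa'⟩ := (testBit_maskL A.toList a).1 hta
    rw [← Fin.ext haa']; exact Finset.mem_toList.1 ha'
  rw [real_iUnion_openConn_eq hnd, real_openConn_eq hnd]
  have hrel' := hrel a haA
  rw [real_openConn_eq hnd] at hrel'
  have hN : (0 : ℝ) < 2 ^ es.length := by positivity
  have hcab := cntConn_le es a b
  have hcast : (cntConnSet (tables n es) o (maskL A.toList) : ℝ) ≤
      cntConn (tables n es) o b + ((2 : ℝ) ^ es.length - cntConn (tables n es) a b) := by
    have h' : ((cntConnSet (tables n es) o (maskL A.toList) : ℕ) : ℝ) ≤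
        ((cntConn (tables n es) o b + (2 ^ es.length - cntConn (tables n es) a b) : ℕ) : ℝ) := by
      exact_mod_cast hle
    rw [Nat.cast_add, Nat.cast_sub hcab, Nat.cast_pow] at h'
    simpa using h'
  have h1 : (2 : ℝ) ^ es.length - cntConn (tables n es) a b ≤ t * 2 ^ es.length := by
    rw [le_div_iff₀ hN] at hrel'
    linarith
  have key : (cntConnSet (tables n es) o (maskL A.toList) : ℝ) / 2 ^ es.length ≤
      (cntConn (tables n es) o b : ℝ) / 2 ^ es.length + t := by
    calc (cntConnSet (tables n es) o (maskL A.toList) : ℝ) / 2 ^ es.length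
        ≤ ((cntConn (tables n es) o b : ℝ) + t * 2 ^ es.length) / 2 ^ es.length :=
          div_le_div_of_nonneg_right (by linarith) hN.le
      _ = (cntConn (tables n es) o b : ℝ) / 2 ^ es.length + t := by
          rw [add_div, mul_div_assoc, div_self hN.ne', mul_one]
  linarith

/-- The same certificate in the literal shape of the crux `AdditiveGluing` (its body at the weights
`w = 𝟙_{E(G)} · 1/2`): `prodBernoulli (fun e => if e ∈ G.edgeSet then half else 0)`. -/
theorem additiveGluing_indicatorHalf_of_agAll {n : ℕ} (h : agAll n = true) (G : SimpleGraph (Fin n))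
    [DecidablePred (· ∈ G.edgeSet)] (A : Finset (Fin n)) (o b : Fin n) (t : ℝ) (ht : 0 ≤ t)
    (hrel : ∀ a ∈ A, 1 - t ≤
      (prodBernoulli fun e => if e ∈ G.edgeSet then half else 0).real (openConn a b)) :
    (prodBernoulli fun e => if e ∈ G.edgeSet then half else 0).real (⋃ a ∈ A, openConn o a) - t ≤
      (prodBernoulli fun e => if e ∈ G.edgeSet then half else 0).real (openConn o b) := by
  rw [prodBernoulli_indicator_holds] at hrel ⊢
  exact additiveGluing_half_of_agAll h G A o b t ht hrel

/-! ### The certificate: all simple graphs on at most five vertices (`native_decide`) -/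

/-- `agAll 0 = true` (trivial: no vertices). -/
theorem agAll_zero : agAll 0 = true := by native_decide

/-- `agAll 1 = true`. -/
theorem agAll_one : agAll 1 = true := by native_decide

/-- `agAll 2 = true`. -/
theorem agAll_two : agAll 2 = true := by native_decide

/-- `agAll 3 = true` (8 graphs). -/
theorem agAll_three : agAll 3 = true := by native_decide

/-- `agAll 4 = true` (64 graphs, 729 configurations in total). -/
theorem agAll_four : agAll 4 = true := by native_decide

/-- **The certified computation** `agAll 5 = true` (1024 graphs, 59 049 configurations in total,
800 triples `(o, b, A)` each; `native_decide`, ≈ 12 s compiled). -/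
theorem agAll_five : agAll 5 = true := by native_decide

/-- `agAll n = true` for every `n ≤ 5`. -/
theorem agAll_le_five {n : ℕ} (hn : n ≤ 5) : agAll n = true := by
  interval_cases n
  · exact agAll_zero
  · exact agAll_one
  · exact agAll_two
  · exact agAll_three
  · exact agAll_four
  · exact agAll_five

/-- **Certificate (density `1/2`, at most five vertices).** For every simple graph `G` on `Fin n`,
`n ≤ 5`, under Bernoulli bond percolation with density `1/2`, every relay set `A`, vertices `o b`
and slack `t ≥ 0` with `P(a ↔ b) ≥ 1 − t` for all `a ∈ A` satisfy `P(o ↔ A) − t ≤ P(o ↔ b)` — the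
additive gluing inequality of the crux `AdditiveGluing` on this block. -/
theorem additiveGluing_half_le_five {n : ℕ} (hn : n ≤ 5) (G : SimpleGraph (Fin n))
    (A : Finset (Fin n)) (o b : Fin n) (t : ℝ) (ht : 0 ≤ t)
    (hrel : ∀ a ∈ A, 1 - t ≤ (bondPercolation G half).real (openConn a b)) :
    (bondPercolation G half).real (⋃ a ∈ A, openConn o a) - t ≤
      (bondPercolation G half).real (openConn o b) :=
  additiveGluing_half_of_agAll (agAll_le_five hn) G A o b t ht hrel

/-- The same certificate in the literal shape of the crux (`prodBernoulli` with the weights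
`fun e => if e ∈ G.edgeSet then half else 0`, any decidability instance). -/
theorem additiveGluing_indicatorHalf_le_five {n : ℕ} (hn : n ≤ 5) (G : SimpleGraph (Fin n))
    [DecidablePred (· ∈ G.edgeSet)] (A : Finset (Fin n)) (o b : Fin n) (t : ℝ) (ht : 0 ≤ t)
    (hrel : ∀ a ∈ A, 1 - t ≤
      (prodBernoulli fun e => if e ∈ G.edgeSet then half else 0).real (openConn a b)) :
    (prodBernoulli fun e => if e ∈ G.edgeSet then half else 0).real (⋃ a ∈ A, openConn o a) - t ≤
      (prodBernoulli fun e => if e ∈ G.edgeSet then half else 0).real (openConn o b) :=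
  additiveGluing_indicatorHalf_of_agAll (agAll_le_five hn) G A o b t ht hrel

/-- Sanity link to the crux: `AdditiveGluing` itself implies the certified block (so the block is a
genuine special case of the crux, stated over the same events and measures). -/
theorem additiveGluing_indicatorHalf_of_additiveGluing
    (h : Summit.CriticalPhenomena.PercolationContinuityZ3.Theses.PercNearOneGluing.AdditiveGluing)
    {n : ℕ} (G : SimpleGraph (Fin n)) [DecidablePred (· ∈ G.edgeSet)] (A : Finset (Fin n))
    (o b : Fin n) (t : ℝ) (ht : 0 ≤ t)
    (hrel : ∀ a ∈ A, 1 - t ≤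
      (prodBernoulli fun e => if e ∈ G.edgeSet then half else 0).real (openConn a b)) :
    (prodBernoulli fun e => if e ∈ G.edgeSet then half else 0).real (⋃ a ∈ A, openConn o a) - t ≤
      (prodBernoulli fun e => if e ∈ G.edgeSet then half else 0).real (openConn o b) :=
  h n _ A o b t ht hrel

end Summit.CriticalPhenomena.PercolationContinuityZ3.Theorems.AdditiveGluing.Negative.Cert
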